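import Literature.NumberTheory.LFunctions.YoshidaWindowGramTailMSPrimeSums
import HarnessLib

/-!
# Kernel enclosures of Yoshida's matrix coefficients — VIII-d: boxes of the mean-square tail matrices `U₂⁺`, `U₂⁻`

Source: H. Yoshida, Adv. Stud. Pure Math. **21** (1992) 281–325, §§6–7 [Yoshida1992HermitianForms].  `Encl.u2EvenJMSBox` /
`Encl.u2OddJMSBox` with `mem_u2EvenJMSBox` / `mem_u2OddJMSBox`: kernel enclosures of the mean-square order-`J` tail matrices
(part VIII-a/b) from the constants, the front-door constants, the table records and value-indexed sine data (part VIII-c);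
`θ = θn/θd`, `η = ηn/ηd`, `d₀ = d0z·2^{−cd}`.  The sine FACTS of the door (`hs₁`, `hsm`, `hsp`) are NOT used by the boxes (they only
read the data); they are discharged separately (part VIII-e, `checkSines`).  Everything is proved; no named facts.
-/

open Real Complex Finset Matrix
open scoped BigOperators

namespace Literature.NumberTheory.LFunctions.Yoshida1992

open Literature.Analysis.SpecialFunctions Literature.Analysis.ValidatedNumerics.NumericsMP
open Literature.Analysis.ValidatedNumerics
open scoped ArithmeticFunction.vonMangoldt

namespace Encl

variable {S : ℕ} {a : ℝ} {ks : List PrimeLen} {C : Consts}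

/-- box of `hankHMS c R p X Y B Z Je j j'`. [cite: Moore1966, Ch. 3 (interval arithmetic: inclusion property)] -/
def hankHMSBox (S : ℕ) (cB RB : MI) (p : ℕ → ℕ) (X Y B Z Je : ℕ) (j j' : ℕ) : MI :=
  (cB.mul S (hankPBox S (p j + p j' - 1) X Y)).add
    (if j = j' then
      (cB.mul S (sumBox S (fun j'' ↦ ((hankMBox S (p j + p j'' - 1) X Y).mulInt ((B : ℤ) ^ p j'')).divNat (B ^ p j)) Je)).add
        (sumBox S (fun j'' ↦ (RB.mulInt ((B : ℤ) ^ p j'')).divNat (Z ^ (p j + p j'') * B ^ p j)) Je)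
     else MI.ofInt S 0)

/-- [cite: Moore1966, Ch. 3 (interval arithmetic: inclusion property)] -/
theorem mem_hankHMSBox (hS : 0 < S) {c R : ℝ} {cB RB : MI} (hc : MI.mem S c cB) (hR : MI.mem S R RB) {p : ℕ → ℕ}
    (hp : ∀ j, 1 ≤ p j) {X Y B Z Je : ℕ} (hX : 0 < X) (hY : 0 < Y) (hB : 0 < B) (hZ : 0 < Z) (j j' : ℕ) :
    MI.mem S (hankHMS c R p X Y B Z Je j j') (hankHMSBox S cB RB p X Y B Z Je j j') := by
  unfold hankHMS hankHMSBox
  refine MI.mem_add (MI.mem_mul hS hc (mem_hankPBox S (by have := hp j; have := hp j'; omega) hX hY)) ?_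
  split_ifs with h
  · refine MI.mem_add (MI.mem_mul hS hc (mem_sumBox S Je fun j'' _ ↦ ?_)) (mem_sumBox S Je fun j'' _ ↦ ?_)
    · have hm := MI.mem_divNat (MI.mem_mulInt (mem_hankMBox S (e := p j + p j'' - 1) (by have := hp j; have := hp j''; omega) hX hY)
        ((B : ℤ) ^ p j'')) (n := B ^ p j) (by positivity)
      refine mem_of_eq hm ?_
      push_cast; ring
    · have hm := MI.mem_divNat (MI.mem_mulInt hR ((B : ℤ) ^ p j'')) (n := Z ^ (p j + p j'') * B ^ p j) (by positivity)
      refine mem_of_eq hm ?_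
      have hZ' : (Z : ℝ) ≠ 0 := by exact_mod_cast hZ.ne'
      have hB' : (B : ℝ) ≠ 0 := by exact_mod_cast hB.ne'
      push_cast
      field_simp
  · simpa using MI.mem_ofInt S 0

/-- **Kernel box of the mean-square `U₂⁺(i,i')`.** [cite: Yoshida1992HermitianForms, §7 pp. 305–312] -/
def u2EvenJMSBox (S : ℕ) (C : Consts) (F : FDConsts) (ks : List PrimeLen) (tab : List IdxRec)
    (cd d0z Be B3e Je θn θd ηn ηd cs : ℕ) (sd1 : List ℕ) (sdm sdp : List (List ℕ)) (i i' : ℕ) : MI :=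
  let cA := (((MI.ofInt S 1).mul S F.invPi2).mulInt (((θd + θn) * (ηd + ηn) * 2 ^ cd : ℕ) : ℤ)).divNat (θd * ηd * d0z)
  let cM := msConstBox S C F ks B3e sd1 sdm sdp
  let cR := msResBox S C ks sd1 sdm sdp cs
  let tA := sumBox S (fun j ↦ sumBox S (fun j' ↦
    ((hankHMSBox S cM cR pA (B3e - 1) B3e Be B3e Je j j').mul S (vAeBox S i j)).mul S (vAeBox S i' j')) Je) Je
  let cB := ((MI.ofInt S 1).mulInt (((θd + θn) * (ηn + ηd) * 2 ^ cd : ℕ) : ℤ)).divNat (θd * ηn * d0z)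
  let tB := sumBox S (fun r ↦ sumBox S (fun r' ↦
    ((hankHBox S pB (B3e - 1) B3e Be Je r r').mul S (vBeBox S C F (tget tab i) i r)).mul S
      (vBeBox S C F (tget tab i') i' r')) Je) Je
  let t := (cA.mul S tA).add (cB.mul S tB)
  if i = i' then
    t.add ((((MI.ofInt S 1).mulInt (((θn + θd) * Be * 2 ^ cd : ℕ) : ℤ)).divNat
      (θn * d0z * (4 * Je + 1) * (B3e - 1) ^ (4 * Je + 1))).mul S ((rhoEBox S C F (tget tab i) Je i).sqr S))
  else t

/-- **`u2EvenJMSBox ∋ U₂⁺(i,i')`** (mean-square tail; `s = sFun/sFun2` data). [cite: Yoshida1992HermitianForms, §7 pp. 305–312] -/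
theorem mem_u2EvenJMSBox (hS : 0 < S) (hks : PrimeData a ks) (hC : ConstsValid S a ks C) {F : FDConsts}
    (hF : FDValid S a F) {tab : List IdxRec} {N : ℕ} (hT : TabValid S a ks N tab)
    {cd d0z Be B3e Je θn θd ηn ηd cs : ℕ} {sd1 : List ℕ} {sdm sdp : List (List ℕ)}
    (hd0 : 0 < d0z) (hθn : 0 < θn) (hθd : 0 < θd) (hηn : 0 < ηn) (hηd : 0 < ηd)
    (hBe : 0 < Be) (hB3 : 2 ≤ B3e) {i i' : ℕ} (hi : i < N) (hi' : i' < N) :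
    MI.mem S (U2EvenJMS a ((θn : ℝ) / θd) ((ηn : ℝ) / ηd) ((d0z : ℝ) * (1 / 2 ^ cd)) Be B3e Je
        (sFun sd1 cs) (sFun2 sdm cs) (sFun2 sdp cs) i i')
      (u2EvenJMSBox S C F ks tab cd d0z Be B3e Je θn θd ηn ηd cs sd1 sdm sdp i i') := by
  rw [← U2EvenJMS'_eq]
  have hRi : OffValid S a ks (i : ℤ) (tget tab i) := (hT i hi).1
  have hRi' : OffValid S a ks (i' : ℤ) (tget tab i') := (hT i' hi').1
  have hX : 0 < B3e - 1 := by omega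
  have hπ : (π : ℝ) ≠ 0 := Real.pi_ne_zero
  have hθd' : (θd : ℝ) ≠ 0 := by exact_mod_cast hθd.ne'
  have hθn' : (θn : ℝ) ≠ 0 := by exact_mod_cast hθn.ne'
  have hηd' : (ηd : ℝ) ≠ 0 := by exact_mod_cast hηd.ne'
  have hηn' : (ηn : ℝ) ≠ 0 := by exact_mod_cast hηn.ne'
  have hd0' : (d0z : ℝ) ≠ 0 := by exact_mod_cast hd0.ne'
  have h2 : (2 : ℝ) ^ cd ≠ 0 := by positivity
  have hpA : ∀ j, 1 ≤ pA j := fun j ↦ by simp [pA]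
  have hpB : ∀ j, 1 ≤ pB j := fun j ↦ by simp [pB]
  have hcM := mem_msConstBox hS hks hC hF (Y := B3e) (by omega) sd1 sdm sdp cs
  have hcR := mem_msResBox hS hks hC sd1 sdm sdp cs
  have hcA : MI.mem S ((1 + (θn : ℝ) / θd) * (1 + (ηn : ℝ) / ηd) * (1 / (π ^ 2 * ((d0z : ℝ) * (1 / 2 ^ cd)))))
      ((((MI.ofInt S 1).mul S F.invPi2).mulInt (((θd + θn) * (ηd + ηn) * 2 ^ cd : ℕ) : ℤ)).divNat (θd * ηd * d0z)) := by
    have h := MI.mem_divNat (MI.mem_mulInt (MI.mem_mul hS (MI.mem_ofInt S 1) hF.invPi2)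
      (((θd + θn) * (ηd + ηn) * 2 ^ cd : ℕ) : ℤ)) (n := θd * ηd * d0z) (by positivity)
    refine mem_of_eq h ?_
    push_cast
    field_simp
  have hcB : MI.mem S ((1 + (θn : ℝ) / θd) * (1 + ((ηn : ℝ) / ηd)⁻¹) * (1 / ((d0z : ℝ) * (1 / 2 ^ cd))))
      (((MI.ofInt S 1).mulInt (((θd + θn) * (ηn + ηd) * 2 ^ cd : ℕ) : ℤ)).divNat (θd * ηn * d0z)) := by
    have h := MI.mem_divNat (MI.mem_mulInt (MI.mem_ofInt S 1) (((θd + θn) * (ηn + ηd) * 2 ^ cd : ℕ) : ℤ))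
      (n := θd * ηn * d0z) (by positivity)
    refine mem_of_eq h ?_
    push_cast
    field_simp
  have hcRR : MI.mem S ((1 + ((θn : ℝ) / θd)⁻¹) * ((Be : ℝ) / ((d0z : ℝ) * (1 / 2 ^ cd) *
      ((4 * Je + 1 : ℕ) * (((B3e - 1 : ℕ) : ℝ)) ^ (4 * Je + 1)))))
      (((MI.ofInt S 1).mulInt (((θn + θd) * Be * 2 ^ cd : ℕ) : ℤ)).divNat
        (θn * d0z * (4 * Je + 1) * (B3e - 1) ^ (4 * Je + 1))) := by
    have h := MI.mem_divNat (MI.mem_mulInt (MI.mem_ofInt S 1) (((θn + θd) * Be * 2 ^ cd : ℕ) : ℤ))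
      (n := θn * d0z * (4 * Je + 1) * (B3e - 1) ^ (4 * Je + 1)) (by positivity)
    refine mem_of_eq h ?_
    have hX' : (((B3e - 1 : ℕ) : ℝ)) ≠ 0 := by exact_mod_cast hX.ne'
    push_cast
    field_simp
  have htA : MI.mem S (∑ j ∈ Finset.range Je, ∑ j' ∈ Finset.range Je,
      hankHMS (msConst a B3e (sFun sd1 cs) (sFun2 sdm cs) (sFun2 sdp cs)) (msRes a (sFun sd1 cs) (sFun2 sdm cs) (sFun2 sdp cs))
        pA (B3e - 1) B3e Be B3e Je j j' * vAe i j * vAe i' j')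
      (sumBox S (fun j ↦ sumBox S (fun j' ↦
        ((hankHMSBox S (msConstBox S C F ks B3e sd1 sdm sdp) (msResBox S C ks sd1 sdm sdp cs) pA (B3e - 1) B3e Be B3e Je j j').mul S
          (vAeBox S i j)).mul S (vAeBox S i' j')) Je) Je) :=
    mem_sumBox S Je fun j _ ↦ mem_sumBox S Je fun j' _ ↦
      MI.mem_mul hS (MI.mem_mul hS (mem_hankHMSBox hS hcM hcR hpA hX (by omega) hBe (by omega) j j') (mem_vAeBox S i j))
        (mem_vAeBox S i' j')
  have htB : MI.mem S (∑ r ∈ Finset.range Je, ∑ r' ∈ Finset.range Je,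
      hankH pB (B3e - 1) B3e Be Je r r' * vBe a i r * vBe a i' r')
      (sumBox S (fun r ↦ sumBox S (fun r' ↦
        ((hankHBox S pB (B3e - 1) B3e Be Je r r').mul S (vBeBox S C F (tget tab i) i r)).mul S
          (vBeBox S C F (tget tab i') i' r')) Je) Je) :=
    mem_sumBox S Je fun r _ ↦ mem_sumBox S Je fun r' _ ↦
      MI.mem_mul hS (MI.mem_mul hS (mem_hankHBox S hpB hX (by omega) hBe r r') (mem_vBeBox hS hks hC hF hRi))
        (mem_vBeBox hS hks hC hF hRi')
  have ht := MI.mem_add (MI.mem_mul hS hcA htA) (MI.mem_mul hS hcB htB)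
  unfold U2EvenJMS' u2EvenJMSBox
  simp only
  by_cases hii : i = i'
  · subst hii
    simp only [if_true]
    exact MI.mem_add ht (MI.mem_mul hS hcRR (MI.mem_sqr hS (mem_rhoEBox hS hC hF hRi)))
  · simp only [hii, if_false, add_zero]
    exact ht

/-- **Kernel box of the mean-square `U₂⁻(k,k')`** (records at modes `k+1`, `k'+1`). [cite: Yoshida1992HermitianForms, §7 pp. 305–312] -/
def u2OddJMSBox (S : ℕ) (C : Consts) (F : FDConsts) (ks : List PrimeLen) (tab : List IdxRec)
    (cd d0z Bo B3o Jo θn θd ηn ηd cs : ℕ) (sd1 : List ℕ) (sdm sdp : List (List ℕ)) (k k' : ℕ) : MI :=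
  let cA := (((MI.ofInt S 1).mul S F.invPi2).mulInt (((θd + θn) * (ηd + ηn) * 2 ^ cd : ℕ) : ℤ)).divNat (θd * ηd * d0z)
  let cM := msConstBox S C F ks (B3o + 1) sd1 sdm sdp
  let cR := msResBox S C ks sd1 sdm sdp cs
  let tA := sumBox S (fun j ↦ sumBox S (fun j' ↦
    ((hankHMSBox S cM cR pOA B3o (B3o + 1) Bo (B3o + 1) Jo j j').mul S (vAoBox S k j)).mul S (vAoBox S k' j')) Jo) Jo
  let cB := ((MI.ofInt S 1).mulInt (((θd + θn) * (ηn + ηd) * 2 ^ cd : ℕ) : ℤ)).divNat (θd * ηn * d0z)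
  let tB := sumBox S (fun r ↦ sumBox S (fun r' ↦
    ((hankHBox S pOB B3o (B3o + 1) Bo Jo r r').mul S (vBoBox S C F (tget tab (k + 1)) k r)).mul S
      (vBoBox S C F (tget tab (k' + 1)) k' r')) Jo) Jo
  let t := (cA.mul S tA).add (cB.mul S tB)
  if k = k' then
    t.add ((((MI.ofInt S 1).mulInt (((θn + θd) * Bo * 2 ^ cd : ℕ) : ℤ)).divNat
      (θn * d0z * (4 * Jo + 1) * B3o ^ (4 * Jo + 1))).mul S ((rhoOBox S C F (tget tab (k + 1)) Jo k).sqr S))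
  else t

/-- **`u2OddJMSBox ∋ U₂⁻(k,k')`** (mean-square tail; table valid below `N`, `k+1, k'+1 < N`). [cite: Yoshida1992HermitianForms, §7 pp. 305–312] -/
theorem mem_u2OddJMSBox (hS : 0 < S) (hks : PrimeData a ks) (hC : ConstsValid S a ks C) {F : FDConsts}
    (hF : FDValid S a F) {tab : List IdxRec} {N : ℕ} (hT : TabValid S a ks N tab)
    {cd d0z Bo B3o Jo θn θd ηn ηd cs : ℕ} {sd1 : List ℕ} {sdm sdp : List (List ℕ)}
    (hd0 : 0 < d0z) (hθn : 0 < θn) (hθd : 0 < θd) (hηn : 0 < ηn) (hηd : 0 < ηd)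
    (hBo : 0 < Bo) (hB3 : 1 ≤ B3o) {k k' : ℕ} (hk : k + 1 < N) (hk' : k' + 1 < N) :
    MI.mem S (U2OddJMS a ((θn : ℝ) / θd) ((ηn : ℝ) / ηd) ((d0z : ℝ) * (1 / 2 ^ cd)) Bo B3o Jo
        (sFun sd1 cs) (sFun2 sdm cs) (sFun2 sdp cs) k k')
      (u2OddJMSBox S C F ks tab cd d0z Bo B3o Jo θn θd ηn ηd cs sd1 sdm sdp k k') := by
  rw [← U2OddJMS'_eq]
  have ek : (((k + 1 : ℕ) : ℤ)) = (k : ℤ) + 1 := by push_cast; ring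
  have ek' : (((k' + 1 : ℕ) : ℤ)) = (k' : ℤ) + 1 := by push_cast; ring
  have hRk : OffValid S a ks ((k : ℤ) + 1) (tget tab (k + 1)) := by
    have h := (hT (k + 1) hk).1; rwa [ek] at h
  have hRk' : OffValid S a ks ((k' : ℤ) + 1) (tget tab (k' + 1)) := by
    have h := (hT (k' + 1) hk').1; rwa [ek'] at h
  have hπ : (π : ℝ) ≠ 0 := Real.pi_ne_zero
  have hθd' : (θd : ℝ) ≠ 0 := by exact_mod_cast hθd.ne'
  have hθn' : (θn : ℝ) ≠ 0 := by exact_mod_cast hθn.ne'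
  have hηd' : (ηd : ℝ) ≠ 0 := by exact_mod_cast hηd.ne'
  have hηn' : (ηn : ℝ) ≠ 0 := by exact_mod_cast hηn.ne'
  have hd0' : (d0z : ℝ) ≠ 0 := by exact_mod_cast hd0.ne'
  have h2 : (2 : ℝ) ^ cd ≠ 0 := by positivity
  have hpA : ∀ j, 1 ≤ pOA j := fun j ↦ by simp [pOA]
  have hpB : ∀ j, 1 ≤ pOB j := fun j ↦ by simp [pOB]
  have hcM := mem_msConstBox hS hks hC hF (Y := B3o + 1) (by omega) sd1 sdm sdp cs
  have hcR := mem_msResBox hS hks hC sd1 sdm sdp cs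
  have hcA : MI.mem S ((1 + (θn : ℝ) / θd) * (1 + (ηn : ℝ) / ηd) * (1 / (π ^ 2 * ((d0z : ℝ) * (1 / 2 ^ cd)))))
      ((((MI.ofInt S 1).mul S F.invPi2).mulInt (((θd + θn) * (ηd + ηn) * 2 ^ cd : ℕ) : ℤ)).divNat (θd * ηd * d0z)) := by
    have h := MI.mem_divNat (MI.mem_mulInt (MI.mem_mul hS (MI.mem_ofInt S 1) hF.invPi2)
      (((θd + θn) * (ηd + ηn) * 2 ^ cd : ℕ) : ℤ)) (n := θd * ηd * d0z) (by positivity)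
    refine mem_of_eq h ?_
    push_cast
    field_simp
  have hcB : MI.mem S ((1 + (θn : ℝ) / θd) * (1 + ((ηn : ℝ) / ηd)⁻¹) * (1 / ((d0z : ℝ) * (1 / 2 ^ cd))))
      (((MI.ofInt S 1).mulInt (((θd + θn) * (ηn + ηd) * 2 ^ cd : ℕ) : ℤ)).divNat (θd * ηn * d0z)) := by
    have h := MI.mem_divNat (MI.mem_mulInt (MI.mem_ofInt S 1) (((θd + θn) * (ηn + ηd) * 2 ^ cd : ℕ) : ℤ))
      (n := θd * ηn * d0z) (by positivity)
    refine mem_of_eq h ?_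
    push_cast
    field_simp
  have hcRR : MI.mem S ((1 + ((θn : ℝ) / θd)⁻¹) * ((Bo : ℝ) / ((d0z : ℝ) * (1 / 2 ^ cd) *
      ((4 * Jo + 1 : ℕ) * (B3o : ℝ) ^ (4 * Jo + 1)))))
      (((MI.ofInt S 1).mulInt (((θn + θd) * Bo * 2 ^ cd : ℕ) : ℤ)).divNat
        (θn * d0z * (4 * Jo + 1) * B3o ^ (4 * Jo + 1))) := by
    have h := MI.mem_divNat (MI.mem_mulInt (MI.mem_ofInt S 1) (((θn + θd) * Bo * 2 ^ cd : ℕ) : ℤ))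
      (n := θn * d0z * (4 * Jo + 1) * B3o ^ (4 * Jo + 1)) (by positivity)
    refine mem_of_eq h ?_
    have hX' : (B3o : ℝ) ≠ 0 := by exact_mod_cast (show B3o ≠ 0 by omega)
    push_cast
    field_simp
  have htA : MI.mem S (∑ j ∈ Finset.range Jo, ∑ j' ∈ Finset.range Jo,
      hankHMS (msConst a (B3o + 1) (sFun sd1 cs) (sFun2 sdm cs) (sFun2 sdp cs)) (msRes a (sFun sd1 cs) (sFun2 sdm cs) (sFun2 sdp cs))
        pOA B3o (B3o + 1) Bo (B3o + 1) Jo j j' * vAo k j * vAo k' j')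
      (sumBox S (fun j ↦ sumBox S (fun j' ↦
        ((hankHMSBox S (msConstBox S C F ks (B3o + 1) sd1 sdm sdp) (msResBox S C ks sd1 sdm sdp cs) pOA B3o (B3o + 1) Bo (B3o + 1) Jo j j').mul S
          (vAoBox S k j)).mul S (vAoBox S k' j')) Jo) Jo) :=
    mem_sumBox S Jo fun j _ ↦ mem_sumBox S Jo fun j' _ ↦
      MI.mem_mul hS (MI.mem_mul hS (mem_hankHMSBox hS hcM hcR hpA (by omega) (by omega) hBo (by omega) j j') (mem_vAoBox S k j))
        (mem_vAoBox S k' j')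
  have htB : MI.mem S (∑ r ∈ Finset.range Jo, ∑ r' ∈ Finset.range Jo,
      hankH pOB B3o (B3o + 1) Bo Jo r r' * vBo a k r * vBo a k' r')
      (sumBox S (fun r ↦ sumBox S (fun r' ↦
        ((hankHBox S pOB B3o (B3o + 1) Bo Jo r r').mul S (vBoBox S C F (tget tab (k + 1)) k r)).mul S
          (vBoBox S C F (tget tab (k' + 1)) k' r')) Jo) Jo) :=
    mem_sumBox S Jo fun r _ ↦ mem_sumBox S Jo fun r' _ ↦
      MI.mem_mul hS (MI.mem_mul hS (mem_hankHBox S hpB (by omega) (by omega) hBo r r') (mem_vBoBox hS hks hC hF hRk))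
        (mem_vBoBox hS hks hC hF hRk')
  have ht := MI.mem_add (MI.mem_mul hS hcA htA) (MI.mem_mul hS hcB htB)
  unfold U2OddJMS' u2OddJMSBox
  simp only
  by_cases hkk : k = k'
  · subst hkk
    simp only [if_true]
    exact MI.mem_add ht (MI.mem_mul hS hcRR (MI.mem_sqr hS (mem_rhoOBox hS hC hF hRk)))
  · simp only [hkk, if_false, add_zero]
    exact ht

end Encl

end Literature.NumberTheory.LFunctions.Yoshida1992
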